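import Mathlib.Tactic
import Mathlib.Data.Set.Card
import Literature.Barriers.PneNP.RelativizationSparseProofs
import Literature.Computability.AlgebraicComplexity.BurgisserThm41Proofs
import Literature.Computability.Complexity.PPolyComplement
import Literature.Computability.Complexity.CircuitEval
import Literature.Computability.Complexity.PolyAdviceClosure
import Literature.Computability.Complexity.StringEquality
import Literature.Computability.Complexity.PairProjections
import Literature.Computability.Complexity.BranchingFn
import Literature.Computability.Complexity.Promise
import Literature.Computability.Cryptography.ClassBQPProofs
import Literature.Computability.Cryptography.ClassBQP
import Summits.QuantumAdvantage.QuantumAdvantage.Statement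
import HarnessLib

/-!
# SoloInformedDenseWitness — witnesses against the advised quantum door are jointly dense

Solo seat `solo-QuantumAdvantage-informed`, session 4, file 18. File 15
(`SoloInformedNonuniformLift`) typed the non-uniform quantum door
`Q-EXT/poly := PromiseBQP ⊆ promiseLift (polyAdvice BQP)` and the non-uniform separation
`PSep/poly := ¬ PromiseBQP ⊆ promiseLift PPoly`, with `Q-EXT/poly ∧ PSep/poly ⟹ BQP ⊄ P/poly ⟹
QuantumAdvantage` and the bracket `PP ⊆ P/poly ⟹ Q-EXT/poly`, `¬Q-EXT/poly ⟹ PP ⊄ P/poly`. The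
seat's memo (r26) asked whether the oracle world of the tree's barrier
`Literature.Barriers.QuantumAdvantage.PromiseLiftRelativization` (an oracle `A = K ⊕ G` with
`BQP^A ⊆ BPP^A` but `PromiseBQP^A ⊄ PromiseBPP'^A`, the witness being the promise problem of ONE
machine read at the inputs `1ⁿ`, i.e. a problem whose two sides are TALLY sets) also refutes the
advised door. This file records the elementary reason why it cannot, and what any witness against
the advised door — relativized or not — must look like.

* **Sparse-sided promise problems are solved by polynomial-size circuits.** If `Q` is disjoint and
  its yes-side OR its no-side is sparse (`|side ∩ {0,1}ⁿ| ≤ n^c + c`), then `Q ∈ promiseLift PPoly`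
  (`mem_promiseLift_PPoly_of_isSparse_yes/no`): the sparse side itself (resp. the complement of
  the sparse side) is a `P/poly` language separating `Q` — Meyer's observation that sparse sets
  have polynomial-size circuits (tree theorem `Literature.Barriers.PneNP.mem_PPoly_of_isSparseLanguage`,
  Berman–Hartmanis 1977 / Schöning 1986 §4) plus `co-P/poly = P/poly`. In particular every
  promise problem with a tally side (`mem_promiseLift_PPoly_of_isTally_yes`), every problem whose
  yes- and no-instances never share a length (`mem_promiseLift_PPoly_of_length_separated`, via the
  one-bit-of-advice lemma `mem_polyAdvice_P_of_length_determined`), and hence every promise problem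
  "of a machine at `1ⁿ`" lies in `promiseLift PPoly ⊆ promiseLift (polyAdvice BQP)`
  (`mem_promiseLift_polyAdvice_BQP_of_isSparse_yes`). The argument ignores oracles (the advice is a
  list of strings / one bit), so it holds verbatim relative to every oracle: a unary witness such as
  the one of `PromiseLiftRelativization` separates the UNIFORM promise classes and can never
  separate `PromiseBQP^A` from `promiseLift (P^A/poly)`.
* **One small side per length suffices.** Sharper: if for some `c` and EVERY length `n` at least
  one of `|Q.yes ∩ {0,1}ⁿ|`, `|Q.no ∩ {0,1}ⁿ|` is `≤ n^c + c`, then `Q ∈ promiseLift PPoly`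
  (`mem_promiseLift_PPoly_of_oneSideSmall`; the circuit family switches, per length, between "accept
  iff listed" and "reject iff listed"; in the tree: the union of a sparse language with the
  intersection of a length-determined language and the complement of a sparse language is in
  `P/poly`, by De Morgan from the tree's `inter_mem_PPoly` and `compl_mem_PPoly`).
* **Hence witnesses are jointly dense.** If a disjoint `Q` is NOT in `promiseLift PPoly` then for
  every `c` there is a length `n` carrying MORE than `n^c + c` yes-instances AND more than `n^c + c`
  no-instances (`jointlyDense_of_not_mem_promiseLift_PPoly`); the same for every `PSep/poly`
  witness `Q ∈ PromiseBQP ∖ promiseLift PPoly` (`promiseSepPoly_witness_jointlyDense`) and for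
  every witness against the advised quantum door, `Q ∈ PromiseBQP ∖ promiseLift (polyAdvice BQP)`
  (`liftPoly_witness_jointlyDense`), and for the language form: `L ∉ P/poly` forces both `L` and
  `Lᶜ` to be non-sparse (`not_isSparse_of_not_mem_PPoly`).

Reading (seat THEOREM MAP, axis "non-uniform"): an oracle or a proof separating `PromiseBQP` from
the advised doors must defeat polynomial advice on super-polynomially many instances of a common
length on both sides — an advice-counting lower bound (of the kind used for `BQP/qpoly`-type
separations), not a one-instance-per-length diagonalization; the uniform barrier world `K ⊕ G` is
silent about `Q-EXT/poly`. No new definitions; all statements are over tree declarations.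

## References
* [BermanHartmanis1977] L. Berman, J. Hartmanis, *On isomorphisms and density of NP and other
  complete sets*, SIAM J. Comput. 6 (1977) 305–322 (sparse sets; polynomial-size circuits for
  sparse sets attributed to A. Meyer) — in the tree through
  `Literature.Barriers.PneNP.mem_PPoly_of_isSparseLanguage` [cite: Schoning1995, §4].
* [KarpLipton1980] R. M. Karp, R. J. Lipton, *Some connections between nonuniform and uniform
  complexity classes*, STOC 1980, 302–309 (`P/poly = P/poly-advice`; tree
  `PPoly_eq_polyAdvice_P_holds`).
* [AroraBarakCC2009] S. Arora, B. Barak, *Computational Complexity*, CUP 2009, Def. 6.5, Def. 6.16,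
  Thm. 6.18, §6.1.
* [Goldreich2006] O. Goldreich, *On promise problems: a survey*, LNCS 3895 (2006), Def. 1.2.
* Tree: `Literature.Barriers.QuantumAdvantage.PromiseLiftRelativization` (the unary witness),
  `Summit.QuantumAdvantage.QuantumAdvantage.Theorems.SoloInformedNonuniformLift` (the doors).
-/

noncomputable section

namespace Summit.QuantumAdvantage.QuantumAdvantage.Theorems

open _root_.Computability Literature.Computability.Complexity Literature.Computability.Cryptography
  Literature.Computability.QuantumComplexity
open Literature.Barriers.PneNP (IsSparseLanguage IsTally finite_slice mem_PPoly_of_isSparseLanguage)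

/-! ### Membership bookkeeping for the lattice operations on `Language Bool` -/

/-- Membership in the infimum of two languages (set intersection). [folklore] -/
private theorem mem_inf_iff' {L₁ L₂ : Language Bool} {x : List Bool} :
    x ∈ L₁ ⊓ L₂ ↔ x ∈ L₁ ∧ x ∈ L₂ := Iff.rfl

/-- Membership in the supremum of two languages (set union). [folklore] -/
private theorem mem_sup_iff' {L₁ L₂ : Language Bool} {x : List Bool} :
    x ∈ L₁ ⊔ L₂ ↔ x ∈ L₁ ∨ x ∈ L₂ := Iff.rfl

/-- Membership in the complement of a language. [folklore] -/
private theorem mem_compl_iff' {L : Language Bool} {x : List Bool} : x ∈ Lᶜ ↔ x ∉ L := Iff.rfl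

/-- Disjointness of a promise problem, pointwise. [Goldreich 2006, Def. 1.1] -/
theorem PromiseProblem.disjoint_iff_forall {Q : PromiseProblem} :
    Q.Disjoint ↔ ∀ ⦃x : List Bool⦄, x ∈ Q.yes → x ∉ Q.no :=
  Set.disjoint_left

/-- `PromiseBQP` problems are disjoint (a yes-instance is accepted with probability `≥ 2/3`, a
no-instance with probability `≤ 1/3`). [Goldreich 2006, Def. 1.1; folklore] -/
theorem disjoint_of_mem_PromiseBQP {Q : PromiseProblem} (hQ : Q ∈ PromiseBQP) : Q.Disjoint := by
  obtain ⟨F, -, -, hFy, hFn⟩ := hQ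
  refine PromiseProblem.disjoint_iff_forall.2 fun x hx hn => ?_
  have h1 := hFy x hx
  have h2 := hFn x hn
  linarith

/-! ### Sparse-sided promise problems -/

/-- **A promise problem with a sparse yes-side is solved by a polynomial-size circuit family**:
the yes-side itself is a `P/poly` language separating `Q`. [Berman–Hartmanis 1977 (Meyer);
Arora–Barak 2009, Def. 6.5] -/
theorem mem_promiseLift_PPoly_of_isSparse_yes {Q : PromiseProblem} (hQ : Q.Disjoint)
    (hs : IsSparseLanguage Q.yes) : Q ∈ promiseLift PPoly :=
  ⟨Q.yes, mem_PPoly_of_isSparseLanguage hs, le_rfl,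
    fun _ hx => mem_compl_iff'.2 fun hy => PromiseProblem.disjoint_iff_forall.1 hQ hy hx⟩

/-- **A promise problem with a sparse no-side is solved by a polynomial-size circuit family**:
the complement of the no-side is a `P/poly` language (`co-P/poly = P/poly`) separating `Q`.
[Berman–Hartmanis 1977 (Meyer); Arora–Barak 2009, §6.1] -/
theorem mem_promiseLift_PPoly_of_isSparse_no {Q : PromiseProblem} (hQ : Q.Disjoint)
    (hs : IsSparseLanguage Q.no) : Q ∈ promiseLift PPoly :=
  ⟨Q.noᶜ, compl_mem_PPoly (mem_PPoly_of_isSparseLanguage hs),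
    fun _ hx => mem_compl_iff'.2 (PromiseProblem.disjoint_iff_forall.1 hQ hx),
    le_of_eq (compl_compl Q.no).symm⟩

/-- In particular a promise problem with a TALLY yes-side (`Q.yes ⊆ 0*`, e.g. the problem of one
machine read at unary inputs) is in `promiseLift PPoly`. [Berman–Hartmanis 1977; folklore] -/
theorem mem_promiseLift_PPoly_of_isTally_yes {Q : PromiseProblem} (hQ : Q.Disjoint)
    (h : IsTally Q.yes) : Q ∈ promiseLift PPoly :=
  mem_promiseLift_PPoly_of_isSparse_yes hQ h.isSparseLanguage

/-! ### Length-determined languages: one bit of advice -/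

/-- **A length-determined language is in `P/1 ⊆ P/poly-advice`**: membership depends only on the
length, so the advice for length `n` is the one bit "`0ⁿ ∈ L`" and the `P` predicate reads it.
[Arora–Barak 2009, Def. 6.16 (every unary language is in `P/poly`); folklore] -/
theorem mem_polyAdvice_P_of_length_determined {L : Language Bool}
    (hL : ∀ ⦃x y : List Bool⦄, x.length = y.length → (x ∈ L ↔ y ∈ L)) :
    L ∈ polyAdvice Classes.P := by
  classical
  refine ⟨{w | (boolUnpair w).2 = [true]}, ?_,
    fun n => if List.replicate n false ∈ L then [true] else [], 1, fun n => ?_, fun x => ?_⟩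
  · exact setOf_apply_eq_apply_mem_P boolUnpairSnd_mem_FP (const_mem_FP [true])
  · show (if List.replicate n false ∈ L then [true] else []).length ≤ Polynomial.eval n 1
    split_ifs <;> simp
  · have key : x ∈ L ↔ List.replicate x.length false ∈ L := hL (by simp)
    rw [key]
    change _ ↔ (boolUnpair (boolPair x (if List.replicate x.length false ∈ L then [true] else []))).2
      = [true]
    rw [boolUnpair_boolPair]
    split_ifs with h <;> simp [h]

/-- A length-determined language is in `P/poly`. [Arora–Barak 2009, Def. 6.16, Thm. 6.18] -/
theorem mem_PPoly_of_length_determined {L : Language Bool}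
    (hL : ∀ ⦃x y : List Bool⦄, x.length = y.length → (x ∈ L ↔ y ∈ L)) : L ∈ PPoly := by
  rw [show PPoly = polyAdvice Classes.P from PPoly_eq_polyAdvice_P_holds]
  exact mem_polyAdvice_P_of_length_determined hL

/-- **A promise problem whose yes- and no-instances never share a length is in `promiseLift
PPoly`**: the length-determined language "some yes-instance has my length" separates it. This
covers every promise problem of the shape `({1ⁿ : n ∈ Y}, {1ⁿ : n ∈ N})` and, more generally,
every problem whose two sides are determined by the input length. [folklore] -/
theorem mem_promiseLift_PPoly_of_length_separated {Q : PromiseProblem}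
    (h : ∀ ⦃x : List Bool⦄, x ∈ Q.yes → ∀ ⦃y : List Bool⦄, y ∈ Q.no → x.length ≠ y.length) :
    Q ∈ promiseLift PPoly := by
  refine ⟨{x | ∃ y ∈ Q.yes, y.length = x.length}, mem_PPoly_of_length_determined ?_,
    fun x hx => ?_, fun x hx => mem_compl_iff'.2 ?_⟩
  · intro x y hxy
    change (∃ z ∈ Q.yes, z.length = x.length) ↔ (∃ z ∈ Q.yes, z.length = y.length)
    rw [hxy]
  · exact ⟨x, hx, rfl⟩
  · rintro ⟨y, hy, hyx⟩
    exact h hy hx hyx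

/-! ### One small side per length suffices -/

/-- **Per-length switching.** If `Q` is disjoint and at EVERY length one of its two sides has at
most `n^c + c` instances, then `Q ∈ promiseLift PPoly`: with `A` the set of lengths where the
yes-side is small, the language `S₁ ∪ (Tᶜ ∩ S₂ᶜ)` — `S₁` the yes-instances at lengths in `A`,
`S₂` the no-instances at lengths outside `A` (both sparse), `T` the (length-determined) strings
with length in `A` — contains `Q.yes`, misses `Q.no`, and is in `P/poly`. [Berman–Hartmanis 1977
(Meyer); Arora–Barak 2009, §6.1; folklore] -/
theorem mem_promiseLift_PPoly_of_oneSideSmall {Q : PromiseProblem} (hQ : Q.Disjoint) (c : ℕ)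
    (h : ∀ n : ℕ, {x : List Bool | x ∈ Q.yes ∧ x.length = n}.ncard ≤ n ^ c + c ∨
      {x : List Bool | x ∈ Q.no ∧ x.length = n}.ncard ≤ n ^ c + c) :
    Q ∈ promiseLift PPoly := by
  classical
  have hdis := PromiseProblem.disjoint_iff_forall.1 hQ
  -- the lengths at which the yes-side is small
  let A : Set ℕ := {n | {x : List Bool | x ∈ Q.yes ∧ x.length = n}.ncard ≤ n ^ c + c}
  let S₁ : Language Bool := {x | x ∈ Q.yes ∧ x.length ∈ A}
  let S₂ : Language Bool := {x | x ∈ Q.no ∧ x.length ∉ A}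
  let T : Language Bool := {x | x.length ∈ A}
  have hS₁ : IsSparseLanguage S₁ := by
    refine ⟨c, fun n => ?_⟩
    by_cases hn : n ∈ A
    · refine le_trans (Set.ncard_le_ncard (fun x hx => ?_) (finite_slice Q.yes n)) hn
      exact ⟨hx.1.1, hx.2⟩
    · have he : {x : List Bool | x ∈ S₁ ∧ x.length = n} = ∅ :=
        Set.eq_empty_iff_forall_notMem.2 fun x hx => hn (hx.2 ▸ hx.1.2)
      rw [he, Set.ncard_empty]; exact Nat.zero_le _
  have hS₂ : IsSparseLanguage S₂ := by
    refine ⟨c, fun n => ?_⟩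
    by_cases hn : n ∈ A
    · have he : {x : List Bool | x ∈ S₂ ∧ x.length = n} = ∅ :=
        Set.eq_empty_iff_forall_notMem.2 fun x hx => hx.1.2 (hx.2 ▸ hn)
      rw [he, Set.ncard_empty]; exact Nat.zero_le _
    · have hno : {x : List Bool | x ∈ Q.no ∧ x.length = n}.ncard ≤ n ^ c + c :=
        (h n).resolve_left hn
      refine le_trans (Set.ncard_le_ncard (fun x hx => ?_) (finite_slice Q.no n)) hno
      exact ⟨hx.1.1, hx.2⟩
  have hT : T ∈ PPoly := mem_PPoly_of_length_determined fun x y hxy => by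
    change x.length ∈ A ↔ y.length ∈ A
    rw [hxy]
  have hM : Tᶜ ⊓ S₂ᶜ ∈ PPoly :=
    Literature.Computability.AlgebraicComplexity.inter_mem_PPoly (compl_mem_PPoly hT)
      (compl_mem_PPoly (mem_PPoly_of_isSparseLanguage hS₂))
  -- the union, by De Morgan from the tree's closure of `P/poly` under `⊓` and `ᶜ`
  have hL : S₁ ⊔ (Tᶜ ⊓ S₂ᶜ) ∈ PPoly := by
    have e' : (S₁ ⊔ (Tᶜ ⊓ S₂ᶜ))ᶜ = S₁ᶜ ⊓ (Tᶜ ⊓ S₂ᶜ)ᶜ := compl_sup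
    have e : S₁ ⊔ (Tᶜ ⊓ S₂ᶜ) = (S₁ᶜ ⊓ (Tᶜ ⊓ S₂ᶜ)ᶜ)ᶜ :=
      (compl_compl (S₁ ⊔ (Tᶜ ⊓ S₂ᶜ))).symm.trans
        (congrArg (fun L : Language Bool => Lᶜ) e')
    rw [e]
    exact compl_mem_PPoly (Literature.Computability.AlgebraicComplexity.inter_mem_PPoly
      (compl_mem_PPoly (mem_PPoly_of_isSparseLanguage hS₁)) (compl_mem_PPoly hM))
  refine ⟨S₁ ⊔ (Tᶜ ⊓ S₂ᶜ), hL, fun x hx => ?_, fun x hx => ?_⟩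
  · -- a yes-instance: listed at small-yes lengths, unlisted (and not a no-instance) elsewhere
    by_cases hn : x.length ∈ A
    · exact mem_sup_iff'.2 (Or.inl ⟨hx, hn⟩)
    · exact mem_sup_iff'.2 (Or.inr (mem_inf_iff'.2
        ⟨mem_compl_iff'.2 hn, mem_compl_iff'.2 fun h₂ => hdis hx h₂.1⟩))
  · -- a no-instance is in neither part
    refine mem_compl_iff'.2 fun hmem => ?_
    rcases mem_sup_iff'.1 hmem with h₁ | h₂
    · exact hdis h₁.1 hx
    · obtain ⟨hT', hS₂'⟩ := mem_inf_iff'.1 h₂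
      by_cases hn : x.length ∈ A
      · exact (mem_compl_iff'.1 hT') hn
      · exact (mem_compl_iff'.1 hS₂') ⟨hx, hn⟩

/-! ### Witnesses are jointly dense -/

/-- **Joint density of witnesses.** A disjoint promise problem outside `promiseLift PPoly` has, for
every `c`, a length with more than `n^c + c` yes-instances AND more than `n^c + c` no-instances.
[folklore; contrapositive of `mem_promiseLift_PPoly_of_oneSideSmall`] -/
theorem jointlyDense_of_not_mem_promiseLift_PPoly {Q : PromiseProblem} (hQ : Q.Disjoint)
    (h : Q ∉ promiseLift PPoly) (c : ℕ) :
    ∃ n : ℕ, n ^ c + c < {x : List Bool | x ∈ Q.yes ∧ x.length = n}.ncard ∧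
      n ^ c + c < {x : List Bool | x ∈ Q.no ∧ x.length = n}.ncard := by
  by_contra hne
  refine h (mem_promiseLift_PPoly_of_oneSideSmall hQ c fun n => ?_)
  by_cases h₁ : {x : List Bool | x ∈ Q.yes ∧ x.length = n}.ncard ≤ n ^ c + c
  · exact Or.inl h₁
  · by_cases h₂ : {x : List Bool | x ∈ Q.no ∧ x.length = n}.ncard ≤ n ^ c + c
    · exact Or.inr h₂
    · exact (hne ⟨n, lt_of_not_ge h₁, lt_of_not_ge h₂⟩).elim

/-- Neither side of such a witness is sparse, and its sides are not separated by length.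
[folklore] -/
theorem not_sparse_sided_of_not_mem_promiseLift_PPoly {Q : PromiseProblem} (hQ : Q.Disjoint)
    (h : Q ∉ promiseLift PPoly) :
    ¬ IsSparseLanguage Q.yes ∧ ¬ IsSparseLanguage Q.no ∧
      ¬ (∀ ⦃x : List Bool⦄, x ∈ Q.yes → ∀ ⦃y : List Bool⦄, y ∈ Q.no → x.length ≠ y.length) :=
  ⟨fun hs => h (mem_promiseLift_PPoly_of_isSparse_yes hQ hs),
    fun hs => h (mem_promiseLift_PPoly_of_isSparse_no hQ hs),
    fun hs => h (mem_promiseLift_PPoly_of_length_separated hs)⟩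

/-- **`PSep/poly` witnesses are jointly dense**: a `PromiseBQP` problem solved by no
polynomial-size circuit family has, for every `c`, a length with more than `n^c + c` instances on
each side of the promise. [folklore] -/
theorem promiseSepPoly_witness_jointlyDense {Q : PromiseProblem} (hBQP : Q ∈ PromiseBQP)
    (h : Q ∉ promiseLift PPoly) (c : ℕ) :
    ∃ n : ℕ, n ^ c + c < {x : List Bool | x ∈ Q.yes ∧ x.length = n}.ncard ∧
      n ^ c + c < {x : List Bool | x ∈ Q.no ∧ x.length = n}.ncard :=
  jointlyDense_of_not_mem_promiseLift_PPoly (disjoint_of_mem_PromiseBQP hBQP) h c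

/-- **Witnesses against the advised quantum door are jointly dense**: if `Q ∈ PromiseBQP` agrees
on its promise with NO language of `BQP/poly` (a counterexample to `Q-EXT/poly` of file 15), then
`Q ∉ promiseLift PPoly`, so `Q` is jointly dense. [folklore] -/
theorem liftPoly_witness_jointlyDense {Q : PromiseProblem} (hBQP : Q ∈ PromiseBQP)
    (h : Q ∉ promiseLift (polyAdvice BQP)) (c : ℕ) :
    ∃ n : ℕ, n ^ c + c < {x : List Bool | x ∈ Q.yes ∧ x.length = n}.ncard ∧
      n ^ c + c < {x : List Bool | x ∈ Q.no ∧ x.length = n}.ncard :=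
  have hsub : PPoly ⊆ polyAdvice BQP := by
    rw [show PPoly = polyAdvice Classes.P from PPoly_eq_polyAdvice_P_holds]
    exact polyAdvice_mono P_subset_BQP_holds
  promiseSepPoly_witness_jointlyDense hBQP (fun h' => h (promiseLift_mono hsub h')) c

/-- Positively: **the advised quantum door is open for every sparse-sided quantum promise
problem** — a `PromiseBQP` problem with a sparse yes-side agrees on its promise with a `P/poly`,
hence with a `BQP/poly`, language. [Berman–Hartmanis 1977 (Meyer); folklore] -/
theorem mem_promiseLift_polyAdvice_BQP_of_isSparse_yes {Q : PromiseProblem} (hBQP : Q ∈ PromiseBQP)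
    (hs : IsSparseLanguage Q.yes) : Q ∈ promiseLift (polyAdvice BQP) := by
  have hsub : PPoly ⊆ polyAdvice BQP := by
    rw [show PPoly = polyAdvice Classes.P from PPoly_eq_polyAdvice_P_holds]
    exact polyAdvice_mono P_subset_BQP_holds
  exact promiseLift_mono hsub
    (mem_promiseLift_PPoly_of_isSparse_yes (disjoint_of_mem_PromiseBQP hBQP) hs)

/-- The same at every length: a `PromiseBQP` problem with one small side per length is solved by a
`BQP/poly` language (indeed by a circuit family). [folklore] -/
theorem mem_promiseLift_polyAdvice_BQP_of_oneSideSmall {Q : PromiseProblem} (hBQP : Q ∈ PromiseBQP)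
    (c : ℕ) (h : ∀ n : ℕ, {x : List Bool | x ∈ Q.yes ∧ x.length = n}.ncard ≤ n ^ c + c ∨
      {x : List Bool | x ∈ Q.no ∧ x.length = n}.ncard ≤ n ^ c + c) :
    Q ∈ promiseLift (polyAdvice BQP) := by
  have hsub : PPoly ⊆ polyAdvice BQP := by
    rw [show PPoly = polyAdvice Classes.P from PPoly_eq_polyAdvice_P_holds]
    exact polyAdvice_mono P_subset_BQP_holds
  exact promiseLift_mono hsub
    (mem_promiseLift_PPoly_of_oneSideSmall (disjoint_of_mem_PromiseBQP hBQP) c h)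

/-- Language form: **a language outside `P/poly` is non-sparse and co-non-sparse** (both `L` and
`Lᶜ` have super-polynomially many strings at some length, for every polynomial bound); e.g. any
witness of `BQP ⊄ P/poly`. [Berman–Hartmanis 1977 (Meyer); folklore] -/
theorem not_isSparse_of_not_mem_PPoly {L : Language Bool} (hL : L ∉ PPoly) :
    ¬ IsSparseLanguage L ∧ ¬ IsSparseLanguage Lᶜ :=
  ⟨fun hs => hL (mem_PPoly_of_isSparseLanguage hs), fun hs => hL (by
    have := compl_mem_PPoly (mem_PPoly_of_isSparseLanguage hs)
    rwa [compl_compl] at this)⟩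

end Summit.QuantumAdvantage.QuantumAdvantage.Theorems

end
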